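import Literature.NumberTheory.EllipticCurves.McCallum1991.HigherLevelKolyvaginClasses
import Literature.NumberTheory.EllipticCurves.McCallum1991.KolyvaginClassesLocalOrderComparison
import Literature.NumberTheory.EllipticCurves.CasselsTateSelmerKolyvaginValue
import Literature.NumberTheory.EllipticCurves.KummerSelmerStructure
import HarnessLib

/-!
# T1 JET (cell `bsd-jet`), road K, input `h61` of the abstract Thm 6.3: Jetchev's Lemma 6.1
# (= print Lemma 5.1 = McCallum 1991 Cor. 3.2, typed fact) in the LOCALISATION / `addOrderOf` currency
# of `JET.Section6.tamagawaExponent_le_mInfty_of_minimalCoreVertex`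

HONEST FRAMING (programme file §HONESTY, verbatim): «no tranche here proves BSD; ARM L moves the
LITERAL column of an r ≤ 1 census into the kernel-proved-modulo-named-print column.» THEOREMS ONLY
(seat `bsd-jet-pv-2`, session g2; `--supports stmt-BirchSwinnertonDyer-14418`, helper); 0 classes
move. WHAT: the abstract kernel Thm 6.3 (p471669) takes
`h61 : ∀ x y, y ≠ 0 → ∃ ℓ, addOrderOf (locP ℓ x) = addOrderOf x ∧ addOrderOf (locM ℓ y) = addOrderOf y`
(a Kolyvagin prime `ℓ` whose localisation preserves the orders of a class `x ∈ H¹(K,E[p^M])^{ε}` and a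
non-zero class `y ∈ H¹(K,E[p^M])^{−ε}`). The typed fact
`McCallum1991.cor32_eigenclasses_infinite_primes_localOrder` (lit-ty, p477423) delivers infinitely many
such `ℓ` in McCallum's currency («`∀ j, p^j c_i ∈ ker(H¹(K,E[p^M]) → H¹(K_v,E[p^M])) ↔ N_i ≤ j`»,
`torsionLocalKer`, independent `τ`-eigenclasses). This file converts:
* `addOrderOf_eq_pow_of_forall_nsmul_eq_zero_iff`, `addOrderOf_map_eq_of_forall_map_nsmul_eq_zero_iff` — the
  «multiples in the kernel» description of a local order IS the order of the localisation;
* `dvd_of_zsmul_add_zsmul_eq_zero_of_eigen` — two `τ`-eigenclasses with opposite signs (p odd) are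
  independent in McCallum's sense;
* `exists_kolyvaginPrime_addOrderOf_localization_eq_of_cor32` — **`h61` in the tree's currency**: for
  `x` with `τx = e x`, `y ≠ 0` with `τy = −e y` (`e = ±1`), level `p^M` (`M ≥ 1`), and any finite set
  `S` of primes to avoid (the primes of `c`), a Kolyvagin prime `ℓ ∉ S` of index `≥ M` with
  `addOrderOf (loc_λ x) = addOrderOf x` and `addOrderOf (loc_λ y) = addOrderOf y` at the place `λ ∣ ℓ`
  (`galoisCohomology.localization`, the `SelmerStructure` currency);
* `addOrderOf_localization_kolyvaginClass_mul_eq_of_prop44` — **`h47` in the tree's currency**: from the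
  typed fact `McCallum1991.prop44_localOrder_kolyvaginClass_mul_eq` (print Prop 4.4 = arXiv Prop 4.7),
  `addOrderOf (loc_λ c_M(mℓ)) = addOrderOf (loc_λ c_M(m))` for compatible data of conductors `m`, `mℓ`.
References: [cite: Jetchev2008, Lemma 5.1 (p. 821) = arXiv Lemma 6.1] [cite: McCallumLMS1991, §3 Cor. 3.2 (p. 299)].
-/

set_option autoImplicit false

noncomputable section

open scoped Classical

open WeierstrassCurve IsDedekindDomain NumberField Literature.NumberTheory.EllipticCurves
  Literature.NumberTheory.EllipticCurves.ModularForms Literature.NumberTheory.GaloisRepresentations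

namespace Summit.BirchSwinnertonDyer.Rank1Residual.JET

/-! ### Orders from «multiples in the kernel» -/

/-- If `p^j • z = 0 ↔ N ≤ j` for every `j`, then `z` has order exactly `p^N`. Elementary.
[cite: McCallumLMS1991, §3 (definition of `ord c_λ`, p. 298)] -/
theorem addOrderOf_eq_pow_of_forall_nsmul_eq_zero_iff {A : Type*} [AddCommGroup A] {p : ℕ}
    (hp : p.Prime) {z : A} {N : ℕ} (h : ∀ j : ℕ, p ^ j • z = 0 ↔ N ≤ j) : addOrderOf z = p ^ N := by
  have hN : p ^ N • z = 0 := (h N).mpr le_rfl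
  obtain ⟨k, hkN, hk⟩ := (Nat.dvd_prime_pow hp).mp (addOrderOf_dvd_of_nsmul_eq_zero hN)
  have hk0 : p ^ k • z = 0 := by rw [← hk]; exact addOrderOf_nsmul_eq_zero z
  have hNk : N ≤ k := (h k).mp hk0
  rw [hk, le_antisymm hkN hNk]

/-- Map version: if `p^j • x ∈ ker f ↔ N ≤ j` for every `j`, then `f x` has order exactly `p^N`.
Elementary. [cite: McCallumLMS1991, §3 (p. 298)] -/
theorem addOrderOf_map_eq_of_forall_map_nsmul_eq_zero_iff {A B : Type*} [AddCommGroup A]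
    [AddCommGroup B] (f : A →+ B) {p : ℕ} (hp : p.Prime) {x : A} {N : ℕ}
    (h : ∀ j : ℕ, f (p ^ j • x) = 0 ↔ N ≤ j) : addOrderOf (f x) = p ^ N :=
  addOrderOf_eq_pow_of_forall_nsmul_eq_zero_iff hp fun j ↦ by
    rw [← map_nsmul]
    exact h j

/-! ### Independence of opposite eigenclasses -/

/-- Two eigenclasses of an additive involution-like operator `τ` with OPPOSITE signs `e`, `−e`
(`e = ±1`) and orders prime to `2` are independent in McCallum's sense: `a₀ • x + a₁ • y = 0` forces
`ord x ∣ a₀` and `ord y ∣ a₁`. (Apply `τ`, add and subtract: `2a₀ • x = 0 = 2a₁ • y`.) Elementary.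
[cite: McCallumLMS1991, §3 (independence, p. 299)] -/
theorem dvd_of_zsmul_add_zsmul_eq_zero_of_eigen {A : Type*} [AddCommGroup A] (τ : A →+ A)
    {e : ℤ} (he : e = 1 ∨ e = -1) {x y : A} (hx : τ x = e • x) (hy : τ y = (-e) • y)
    (hx2 : (addOrderOf x).Coprime 2) (hy2 : (addOrderOf y).Coprime 2)
    {a₀ a₁ : ℤ} (h : a₀ • x + a₁ • y = 0) :
    (addOrderOf x : ℤ) ∣ a₀ ∧ (addOrderOf y : ℤ) ∣ a₁ := by
  have hτ : a₀ • τ x + a₁ • τ y = 0 := by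
    have := congrArg τ h
    simpa only [map_add, map_zsmul, map_zero] using this
  rw [hx, hy] at hτ
  -- `a₀ • x - a₁ • y = 0`
  have hU : a₀ • x - a₁ • y = 0 := by
    rcases he with rfl | rfl
    · simpa [sub_eq_add_neg] using hτ
    · have h' : -(a₀ • x) + a₁ • y = 0 := by simpa [sub_eq_add_neg, smul_neg] using hτ
      have : a₀ • x - a₁ • y = -(-(a₀ • x) + a₁ • y) := by abel
      rw [this, h', neg_zero]
  have h2x : (2 * a₀) • x = 0 := by
    have := congrArg₂ (· + ·) h hU
    simp only [add_zero] at this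
    rw [mul_smul, two_smul]
    calc a₀ • x + a₀ • x = (a₀ • x + a₁ • y) + (a₀ • x - a₁ • y) := by abel
      _ = 0 := this
  have h2y : (2 * a₁) • y = 0 := by
    have := congrArg₂ (· - ·) h hU
    simp only [sub_zero] at this
    rw [mul_smul, two_smul]
    calc a₁ • y + a₁ • y = (a₀ • x + a₁ • y) - (a₀ • x - a₁ • y) := by abel
      _ = 0 := this
  have hdx : (addOrderOf x : ℤ) ∣ 2 * a₀ := addOrderOf_dvd_iff_zsmul_eq_zero.mpr h2x
  have hdy : (addOrderOf y : ℤ) ∣ 2 * a₁ := addOrderOf_dvd_iff_zsmul_eq_zero.mpr h2y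
  have hgx : Int.gcd (addOrderOf x : ℤ) 2 = 1 := by simpa [Int.gcd, Int.natAbs_natCast] using hx2
  have hgy : Int.gcd (addOrderOf y : ℤ) 2 = 1 := by simpa [Int.gcd, Int.natAbs_natCast] using hy2
  exact ⟨Int.dvd_of_dvd_mul_right_of_gcd_one hdx hgx, Int.dvd_of_dvd_mul_right_of_gcd_one hdy hgy⟩

/-! ### Lemma 6.1 in the localisation currency -/

/-- **[J] Lemma 6.1 (= print Lemma 5.1 = [McC] Cor. 3.2) in the currency of the abstract Thm 6.3's
`h61`.** For `W/ℚ` (globally minimal, non-CM), `K` imaginary quadratic, `p` odd with the `p`-adic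
tower, complex conjugation `τ ≠ 1`, a level `p^M` (`M ≥ 1`), a class `x` with `τx = e • x` and a
NON-ZERO class `y` with `τy = −e • y` (`e = ±1`) in `H¹(K, E[p^M])`, and any finite set `S` of rational
primes to avoid: there is a Kolyvagin prime `ℓ ∉ S` (for the free level `N`) of index `≥ M` such that
the localisation at the place `λ` of `K` above `ℓ` PRESERVES the orders of `x` and `y`:
`addOrderOf (loc_λ x) = addOrderOf x`, `addOrderOf (loc_λ y) = addOrderOf y`
(`galoisCohomology.localization`, the Selmer-structure currency). From the typed fact
`McCallum1991.cor32_eigenclasses_infinite_primes_localOrder` with the system `(x, y)` (resp. `(y)` if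
`x = 0`), independence by `dvd_of_zsmul_add_zsmul_eq_zero_of_eigen`, `N_i := M_i`, and the
dictionary `torsionLocalKer = ker loc_λ` (`mem_torsionLocalKer_iff_res_eq_zero`).
[cite: Jetchev2008, Lemma 5.1 (p. 821)] [cite: McCallumLMS1991, §3 Cor. 3.2 (p. 299)] -/
theorem exists_kolyvaginPrime_addOrderOf_localization_eq_of_cor32
    (h32 : McCallum1991.cor32_eigenclasses_infinite_primes_localOrder)
    (N : ℕ) [NeZero N] (W : WeierstrassCurve ℚ) [W.IsElliptic] [W.IsGloballyMinimal]
    (hcm : ¬ W.HasCM) (K : Type) [Field K] [NumberField K] (hK : IsImaginaryQuadratic K)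
    (p : ℕ) [Fact p.Prime] (hp2 : p ≠ 2) (htower : ∀ n : ℕ, W.HasSurjectiveModNGaloisRep (p ^ n : ℕ))
    (τ : K ≃ₐ[ℚ] K) (hτ : τ ≠ 1) (M : ℕ) (hM : 1 ≤ M) {e : ℤ} (he : e = 1 ∨ e = -1)
    (x y : galH1Torsion (W.baseChange K) ((p ^ M : ℕ) : ℤ))
    (hx : conjAct W τ ((p ^ M : ℕ) : ℤ) x = e • x) (hy : conjAct W τ ((p ^ M : ℕ) : ℤ) y = (-e) • y)
    (hy0 : y ≠ 0) (S : Finset ℕ) :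
    ∃ ℓ : ℕ, ℓ ∉ S ∧ Zhang2014.IsKolyvaginPrime N W K p ℓ ∧ M ≤ Zhang2014.kolyvaginIndex W p ℓ ∧
      ∀ v : HeightOneSpectrum (𝓞 K), (ℓ : 𝓞 K) ∈ v.asIdeal →
        addOrderOf (galoisCohomology.localization
            ((W.baseChange K).torsionGaloisModule ((p ^ M : ℕ) : ℤ)) (Sum.inr v) 1 x) = addOrderOf x ∧
        addOrderOf (galoisCohomology.localization
            ((W.baseChange K).torsionGaloisModule ((p ^ M : ℕ) : ℤ)) (Sum.inr v) 1 y) = addOrderOf y := by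
  have hp : p.Prime := Fact.out
  -- every class is killed by `p^M`, so orders are powers of `p` (and prime to `2`)
  have hkill : ∀ z : galH1Torsion (W.baseChange K) ((p ^ M : ℕ) : ℤ), p ^ M • z = 0 := fun z ↦
    galoisCohomology.nsmul_eq_zero_of_forall ((W.baseChange K).torsionGaloisModule ((p ^ M : ℕ) : ℤ))
      (fun T ↦ by
        have h := (W.baseChange K).natAbs_nsmul_geomTorsion T
        rwa [Int.natAbs_natCast] at h) z
  have hordpow : ∀ z : galH1Torsion (W.baseChange K) ((p ^ M : ℕ) : ℤ), ∃ k ≤ M, addOrderOf z = p ^ k :=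
    fun z ↦ (Nat.dvd_prime_pow hp).mp (addOrderOf_dvd_of_nsmul_eq_zero (hkill z))
  have hcop2 : ∀ z : galH1Torsion (W.baseChange K) ((p ^ M : ℕ) : ℤ), (addOrderOf z).Coprime 2 := by
    intro z
    obtain ⟨k, -, hk⟩ := hordpow z
    rw [hk]
    exact Nat.Coprime.pow_left _ ((Nat.coprime_primes hp Nat.prime_two).mpr hp2)
  -- the localisation at the place `v`, typed on `galH1Torsion` (= `galoisCohomology _ 1` by `rfl`)
  let loc : ∀ v : HeightOneSpectrum (𝓞 K), galH1Torsion (W.baseChange K) ((p ^ M : ℕ) : ℤ) →+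
      galoisCohomology (((W.baseChange K).torsionGaloisModule ((p ^ M : ℕ) : ℤ)).toLocal (Sum.inr v)) 1 :=
    fun v ↦ galoisCohomology.localization ((W.baseChange K).torsionGaloisModule ((p ^ M : ℕ) : ℤ))
      (Sum.inr v) 1
  -- dictionary: multiples in `torsionLocalKer` = multiples killed by the localisation
  have hloc : ∀ (v : HeightOneSpectrum (𝓞 K)) (z : galH1Torsion (W.baseChange K) ((p ^ M : ℕ) : ℤ))
      (j : ℕ), loc v (p ^ j • z) = 0 ↔
        ((p ^ j : ℕ) : ℤ) • z ∈ (W.baseChange K).torsionLocalKer (v.adicCompletion K) ((p ^ M : ℕ) : ℤ) := by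
    intro v z j
    haveI : CharZero (v.adicCompletion K) := charZero_of_injective_algebraMap (algebraMap K _).injective
    rw [natCast_zsmul, mem_torsionLocalKer_iff_res_eq_zero (W := W.baseChange K)
      (E := v.adicCompletion K) (pow_ne_zero M hp.ne_zero)]
    exact Iff.rfl
  obtain ⟨b, -, hb⟩ := hordpow y
  have hey : (-e = 1 ∨ -e = -1) := by rcases he with rfl | rfl <;> norm_num
  -- apply Cor 3.2 to an independent system of eigenclasses containing `y` (and `x` if `x ≠ 0`)
  have key : ∃ T : Set ℕ, T.Infinite ∧ ∀ ℓ ∈ T, Zhang2014.IsKolyvaginPrime N W K p ℓ ∧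
      M ≤ Zhang2014.kolyvaginIndex W p ℓ ∧ ∀ v : HeightOneSpectrum (𝓞 K), (ℓ : 𝓞 K) ∈ v.asIdeal →
        addOrderOf (loc v x) = addOrderOf x ∧ addOrderOf (loc v y) = addOrderOf y := by
    by_cases hx0 : x = 0
    · -- the system `(y)`
      have hinf := h32 N W hcm K hK p hp hp2 htower τ hτ M hM 1 ![y]
        (by intro i; fin_cases i; exact hy0)
        (by intro i; fin_cases i; exact ⟨-e, hey, hy⟩)
        (by
          intro a ha i
          fin_cases i
          have ha' : a 0 • y = 0 := by simpa using ha
          exact addOrderOf_dvd_iff_zsmul_eq_zero.mpr ha')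
        ![b] (by intro i; fin_cases i; exact hb) ![b] (fun _ ↦ le_rfl)
      refine ⟨_, hinf, fun ℓ hℓ ↦ ⟨hℓ.2.1, hℓ.2.2.1, fun v hv ↦ ⟨by rw [hx0, map_zero, addOrderOf_zero, addOrderOf_zero], ?_⟩⟩⟩
      rw [hb]
      exact addOrderOf_map_eq_of_forall_map_nsmul_eq_zero_iff (loc v) hp fun j ↦ by
        rw [hloc v y j]; simpa using hℓ.2.2.2 0 v hv j
    · -- the system `(x, y)`
      obtain ⟨a, -, ha⟩ := hordpow x
      have hinf := h32 N W hcm K hK p hp hp2 htower τ hτ M hM 2 ![x, y]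
        (by
          intro i
          fin_cases i
          · exact hx0
          · exact hy0)
        (by
          intro i
          fin_cases i
          · exact ⟨e, he, hx⟩
          · exact ⟨-e, hey, hy⟩)
        (by
          intro c hc i
          have hc' : c 0 • x + c 1 • y = 0 := by simpa [Fin.sum_univ_two] using hc
          obtain ⟨h0, h1⟩ := dvd_of_zsmul_add_zsmul_eq_zero_of_eigen (conjAct W τ ((p ^ M : ℕ) : ℤ)) he
            hx hy (hcop2 x) (hcop2 y) hc'
          fin_cases i
          · exact h0
          · exact h1)
        ![a, b]
        (by
          intro i
          fin_cases i
          · exact ha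
          · exact hb)
        ![a, b] (fun _ ↦ le_rfl)
      refine ⟨_, hinf, fun ℓ hℓ ↦ ⟨hℓ.2.1, hℓ.2.2.1, fun v hv ↦ ⟨?_, ?_⟩⟩⟩
      · rw [ha]
        exact addOrderOf_map_eq_of_forall_map_nsmul_eq_zero_iff (loc v) hp fun j ↦ by
          rw [hloc v x j]; simpa using hℓ.2.2.2 0 v hv j
      · rw [hb]
        exact addOrderOf_map_eq_of_forall_map_nsmul_eq_zero_iff (loc v) hp fun j ↦ by
          rw [hloc v y j]; simpa using hℓ.2.2.2 1 v hv j
  obtain ⟨T, hT, hTprop⟩ := key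
  obtain ⟨ℓ, hℓT, hℓS⟩ := hT.exists_notMem_finset S
  exact ⟨ℓ, hℓS, hTprop ℓ hℓT⟩

/-! ### Prop 4.7 (= print Prop 4.4 = [McC] Prop 4.4) in the localisation currency: `h47` -/

/-- Two elements killed by a power of `p` whose `p^j`-multiples vanish simultaneously have the same
order. Elementary. [cite: McCallumLMS1991, §4 Prop. 4.4 (p. 301)] -/
theorem addOrderOf_eq_addOrderOf_of_forall_nsmul_eq_zero_iff {A B : Type*} [AddCommGroup A]
    [AddCommGroup B] {p : ℕ} (hp : p.Prime) {M : ℕ} {z : A} {w : B} (hz : p ^ M • z = 0)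
    (hw : p ^ M • w = 0) (h : ∀ j : ℕ, p ^ j • z = 0 ↔ p ^ j • w = 0) :
    addOrderOf z = addOrderOf w := by
  obtain ⟨s, -, hs⟩ := (Nat.dvd_prime_pow hp).mp (addOrderOf_dvd_of_nsmul_eq_zero hz)
  obtain ⟨t, -, ht⟩ := (Nat.dvd_prime_pow hp).mp (addOrderOf_dvd_of_nsmul_eq_zero hw)
  have hzs : p ^ s • z = 0 := by rw [← hs]; exact addOrderOf_nsmul_eq_zero z
  have hwt : p ^ t • w = 0 := by rw [← ht]; exact addOrderOf_nsmul_eq_zero w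
  have hts : p ^ t ∣ p ^ s := by rw [← ht]; exact addOrderOf_dvd_of_nsmul_eq_zero ((h s).mp hzs)
  have hst : p ^ s ∣ p ^ t := by rw [← hs]; exact addOrderOf_dvd_of_nsmul_eq_zero ((h t).mpr hwt)
  rw [hs, ht]
  exact Nat.dvd_antisymm hst hts

/-- **[J] Prop 4.7 (= print Prop 4.4 = [McC] Prop 4.4) in the currency of the abstract Thm 6.3's `h47`**:
under the binders of the typed fact `McCallum1991.prop44_localOrder_kolyvaginClass_mul_eq` (lit-ty,
p478965) — compatible Kolyvagin–Heegner data `d` of conductor `m` and `d'` of conductor `mℓ`, level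
`p^M`, the place `λ` of `K` above `ℓ` — the localisations at `λ` of the classes `c_M(mℓ)` and `c_M(m)`
have THE SAME ORDER: `addOrderOf (loc_λ c_M(mℓ)) = addOrderOf (loc_λ c_M(m))`
(`galoisCohomology.localization`). From the fact's «`p^j c_M(mℓ)_λ = 0 ⟺ p^j c_M(m)_λ = 0`» through the
dictionary `torsionLocalKer = ker loc_λ`. [cite: Jetchev2008, Prop. 4.4 (p. 821) = arXiv Prop. 4.7]
[cite: McCallumLMS1991, §4 Prop. 4.4 (p. 301)] -/
theorem addOrderOf_localization_kolyvaginClass_mul_eq_of_prop44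
    (h44 : McCallum1991.prop44_localOrder_kolyvaginClass_mul_eq)
    (W : WeierstrassCurve ℚ) [W.IsElliptic] [W.IsGloballyMinimal] [NeZero (W.conductorNorm ℤ)]
    (hcm : ¬ W.HasCM) (K : Type) [Field K] [NumberField K] (hK : IsImaginaryQuadratic K)
    (hD3 : NumberField.discr K ≠ -3) (hD4 : NumberField.discr K ≠ -4)
    (hH : SatisfiesHeegnerHypothesis (W.conductorNorm ℤ) K)
    (p : ℕ) [Fact p.Prime] (hp2 : p ≠ 2) (htower : ∀ n : ℕ, W.HasSurjectiveModNGaloisRep (p ^ n : ℕ))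
    (Dt : ModularParametrizationData W (W.conductorNorm ℤ)) (β : ℤ) (ι : K →+* ℂ)
    (M : ℕ) (hM : 1 ≤ M) (m l : ℕ) (hml : Squarefree (m * l)) (hl : l.Prime) (hlm : ¬ l ∣ m)
    (hK' : ∀ l' ∈ (m * l).primeFactors, Zhang2014.IsKolyvaginPrime (W.conductorNorm ℤ) W K p l' ∧
      M ≤ Zhang2014.kolyvaginIndex W p l')
    (d : KolyvaginHeegnerData Dt β ι m) (d' : KolyvaginHeegnerData Dt β ι (m * l))
    (hσ : ∀ l' ∈ m.primeFactors, ∀ (x : ringClassField K ι m) (x' : ringClassField K ι (m * l)),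
      (x : ℂ) = x' → ((d'.σ l' x' : ringClassField K ι (m * l)) : ℂ) = (d.σ l' x : ℂ))
    (hS : ∀ s ∈ d.S, ∃ s' ∈ d'.S, ∀ (x : ringClassField K ι m) (x' : ringClassField K ι (m * l)),
      (x : ℂ) = x' → ((s' x' : ringClassField K ι (m * l)) : ℂ) = (s x : ℂ))
    (hS' : ∀ s' ∈ d'.S, ∃ s ∈ d.S, ∀ (x : ringClassField K ι m) (x' : ringClassField K ι (m * l)),
      (x : ℂ) = x' → ((s' x' : ringClassField K ι (m * l)) : ℂ) = (s x : ℂ))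
    (hemb : ∀ (x : ringClassField K ι m) (x' : ringClassField K ι (m * l)),
      (x : ℂ) = x' → d'.emb x' = d.emb x)
    (v : HeightOneSpectrum (𝓞 K)) (hv : (l : 𝓞 K) ∈ v.asIdeal) :
    addOrderOf ((galoisCohomology.localization
        ((W.baseChange K).torsionGaloisModule ((p ^ M : ℕ) : ℤ)) (Sum.inr v) 1 :
          galH1Torsion (W.baseChange K) ((p ^ M : ℕ) : ℤ) →+ _)
        (d'.kolyvaginClass (Fact.out : p.Prime) M)) =
      addOrderOf ((galoisCohomology.localization
        ((W.baseChange K).torsionGaloisModule ((p ^ M : ℕ) : ℤ)) (Sum.inr v) 1 :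
          galH1Torsion (W.baseChange K) ((p ^ M : ℕ) : ℤ) →+ _)
        (d.kolyvaginClass (Fact.out : p.Prime) M)) := by
  have hp : p.Prime := Fact.out
  set loc : galH1Torsion (W.baseChange K) ((p ^ M : ℕ) : ℤ) →+
      galoisCohomology (((W.baseChange K).torsionGaloisModule ((p ^ M : ℕ) : ℤ)).toLocal (Sum.inr v)) 1 :=
    galoisCohomology.localization ((W.baseChange K).torsionGaloisModule ((p ^ M : ℕ) : ℤ)) (Sum.inr v) 1
    with hlocdef
  have hloc : ∀ (z : galH1Torsion (W.baseChange K) ((p ^ M : ℕ) : ℤ)) (j : ℕ), loc (p ^ j • z) = 0 ↔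
      ((p ^ j : ℕ) : ℤ) • z ∈ (W.baseChange K).torsionLocalKer (v.adicCompletion K) ((p ^ M : ℕ) : ℤ) := by
    intro z j
    haveI : CharZero (v.adicCompletion K) := charZero_of_injective_algebraMap (algebraMap K _).injective
    rw [hlocdef, natCast_zsmul, mem_torsionLocalKer_iff_res_eq_zero (W := W.baseChange K)
      (E := v.adicCompletion K) (pow_ne_zero M hp.ne_zero)]
    exact Iff.rfl
  have hkillL : ∀ z : galH1Torsion (W.baseChange K) ((p ^ M : ℕ) : ℤ), p ^ M • loc z = 0 := fun z ↦
    galoisCohomology.nsmul_eq_zero_of_forall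
      (((W.baseChange K).torsionGaloisModule ((p ^ M : ℕ) : ℤ)).toLocal (Sum.inr v))
      (fun T ↦ by
        have h := (W.baseChange K).natAbs_nsmul_geomTorsion T
        rwa [Int.natAbs_natCast] at h) (loc z)
  have h := h44 W hcm K hK hD3 hD4 hH p hp2 htower Dt β ι M hM m l hml hl hlm hK' d d' hσ hS hS' hemb v hv
  refine addOrderOf_eq_addOrderOf_of_forall_nsmul_eq_zero_iff hp (hkillL _) (hkillL _) fun j ↦ ?_
  rw [← map_nsmul, ← map_nsmul]
  exact (hloc _ j).trans ((h j).2.trans (hloc _ j).symm)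

end Summit.BirchSwinnertonDyer.Rank1Residual.JET

end
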